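import Mathlib
import Summits.Ventures.PercRepro2.LeafRowPendantRootStarMasses

/-!
# The second-order mirror (A)-term is nonnegative when `v` is adjacent exactly to `o` and `b`
(blind cell PercRepro2, p5 g31; `proofs/P5-OEDGE.md` §41 (3), S4 §2.4 (s) addendum 16 (c))

With the masses of `LeafRowPendantRootStarMasses` (`P(Q,vL,oH,bH) = 0`,
`P(Q,vL,oH) = (1 − u)·w·P₀₀(Q,oH,bL)`, `P(Q,oH) ≥ P₀₀(Q,oH,¬bL) + (1 − uw)·P₀₀(Q,oH,bL)`,
`π_v ≥ u·P₀₀(oL) + w·P₀₀(bL) − uw·P₀₀(oL,bL)` and their mirrors), BHK06 1.4 and Harris in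
`G − v` (`P₀₀(Q,oH,bL)·P₀₀(Q) ≤ P₀₀(Q,oH)·P₀₀(Q,bL) ≤ P₀₀(Q,oH)·P₀₀(Q)·P₀₀(bL)`) and the
star inequality, **`crossA'so_nonneg_of_star`** is the sign `0 ≤ crossA′so`, and
**`LeafRow_pendant_root_of_star`** closes the pendant-root case of row (LEAF-½) on this class
(the open pin `a₂ = z`).  The certificate is of degree four in the `G − v` masses — the
mechanism invisible to every cone over the masses of `G` alone.  Own work; standard axioms.
-/

namespace Summit.Ventures.PercRepro2

open UnionCluster CovForm CovForm.FirstOrder LeafStep LeafHalfCross LeafRowEdgeCubic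
  LeafRowFirstOrderA LeafRowPendantRootFO LeafRowPendantRootSO LeafRowPendantRootMirrorB
  StarTwoEdges PinTwo LeafRowPendantRootStarMasses

namespace LeafRowPendantRootStarOB

section Main

variable {V : Type*} {E : Type*} [Fintype E] [DecidableEq E] [Fintype V] [DecidableEq V]
  {R : Type*} [Field R] [LinearOrder R] [IsStrictOrderedRing R]
variable {ends : E → Sym2 V} {p : E → R} {e₁ e₂ : E} {o a₁ a₂ v b : V}

/-- **The sign of the second-order mirror (A)-term when `v` is adjacent exactly to `o` and
`b`**: `0 ≤ crossA′so`. -/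
theorem crossA'so_nonneg_of_star (hp : IsProbVec p) (h₁ : ends e₁ = s(v, o))
    (h₂ : ends e₂ = s(v, b)) (hstar : ∀ f, v ∈ ends f → f = e₁ ∨ f = e₂) (hvo : v ≠ o)
    (hvb : v ≠ b) (hv1 : v ≠ a₁) (hv2 : v ≠ a₂) (h12 : e₁ ≠ e₂) :
    0 ≤ crossA'so p ends o a₁ a₂ v b := by
  have hxv := prob_vL_oH (p := p) h₁ h₂ hstar hvo hvb hv1 hv2 h12
  have hyv := prob_vL_bH (p := p) h₁ h₂ hstar hvo hvb hv1 hv2 h12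
  have hDv := prob_vL_oH_bH (p := p) (a₂ := a₂) h₁ h₂ hstar hv1
  have hx := prob_oH_ge hp h₁ h₂ hstar hvo hvb hv1 hv2 h12
  have hy := prob_oH_ge hp h₂ h₁ (fun f hf => (hstar f hf).symm) hvb hvo hv1 hv2 h12.symm
  rw [Function.update_comm h12.symm] at hy
  have hπ := prob_vL_ge hp h₁ h₂ hstar hv1 h12
  unfold crossA'so
  rw [hxv, hyv, hDv]
  set p₀ := Function.update (Function.update p e₁ 0) e₂ 0 with hp₀
  have hp0 : IsProbVec p₀ := (hp.update e₁ le_rfl zero_le_one).update e₂ le_rfl zero_le_one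
  -- the weights
  have hu0 : 0 ≤ p e₁ := hp.1 e₁
  have hu1 : p e₁ ≤ 1 := hp.2 e₁
  have hw0 : 0 ≤ p e₂ := hp.1 e₂
  have hw1 : p e₂ ≤ 1 := hp.2 e₂
  -- the `G − v` masses
  set A₀ := prob p₀ (avoidAll ends a₂ {a₁}) with hA₀
  set xo := prob p₀ (avoidAll ends a₂ {a₁} ∩ connEvent ends a₂ o) with hxo
  set yb := prob p₀ (avoidAll ends a₂ {a₁} ∩ connEvent ends a₂ b) with hyb
  set a1 := prob p₀ (avoidAll ends a₂ {a₁} ∩ connEvent ends a₂ o ∩ connEvent ends a₁ b) with ha1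
  set a2 := prob p₀ (avoidAll ends a₂ {a₁} ∩ connEvent ends a₂ o ∩ (connEvent ends a₁ b)ᶜ) with ha2
  set b1 := prob p₀ (avoidAll ends a₂ {a₁} ∩ connEvent ends a₂ b ∩ connEvent ends a₁ o) with hb1
  set b2 := prob p₀ (avoidAll ends a₂ {a₁} ∩ connEvent ends a₂ b ∩ (connEvent ends a₁ o)ᶜ) with hb2
  set α := prob p₀ (connEvent ends a₁ o) with hα
  set β := prob p₀ (connEvent ends a₁ b) with hβ
  set γ := prob p₀ (connEvent ends a₁ o ∩ connEvent ends a₁ b) with hγ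
  have hxo_split : a1 + a2 = xo :=
    prob_inter_add_prob_inter_compl p₀ (avoidAll ends a₂ {a₁} ∩ connEvent ends a₂ o)
      (connEvent ends a₁ b)
  have hyb_split : b1 + b2 = yb :=
    prob_inter_add_prob_inter_compl p₀ (avoidAll ends a₂ {a₁} ∩ connEvent ends a₂ b)
      (connEvent ends a₁ o)
  -- BHK06 1.4 and Harris in `G − v`
  have hxo0 : 0 ≤ xo := prob_nonneg hp0 _
  have hyb0 : 0 ≤ yb := prob_nonneg hp0 _
  have bhk_o : a1 * A₀ ≤ xo * (A₀ * β) := by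
    have h := anticov_nonneg_of_cross' p₀ ends hp0 a₁ a₂ o b
    unfold anticov at h
    rw [← Set.inter_assoc] at h
    have hh : prob p₀ (avoidAll ends a₂ {a₁} ∩ connEvent ends a₁ b) ≤ A₀ * β :=
      prob_inter_le_prob_mul_prob_of_isLowerSet hp0 (isLowerSet_Q ends a₁ a₂)
        (isUpperSet_connEvent ends a₁ b)
    have := mul_le_mul_of_nonneg_left hh hxo0
    linarith only [h, this]
  have bhk_b : b1 * A₀ ≤ yb * (A₀ * α) := by
    have h := anticov_nonneg_of_cross' p₀ ends hp0 a₁ a₂ b o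
    unfold anticov at h
    rw [← Set.inter_assoc] at h
    have hh : prob p₀ (avoidAll ends a₂ {a₁} ∩ connEvent ends a₁ o) ≤ A₀ * α :=
      prob_inter_le_prob_mul_prob_of_isLowerSet hp0 (isLowerSet_Q ends a₁ a₂)
        (isUpperSet_connEvent ends a₁ o)
    have := mul_le_mul_of_nonneg_left hh hyb0
    linarith only [h, this]
  -- bounds on the parameters
  have hα0 : 0 ≤ α := prob_nonneg hp0 _
  have hα1 : α ≤ 1 := prob_le_one hp0 _
  have hβ0 : 0 ≤ β := prob_nonneg hp0 _
  have hβ1 : β ≤ 1 := prob_le_one hp0 _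
  have hγα : γ ≤ α := prob_mono hp0 Set.inter_subset_left
  have hγβ : γ ≤ β := prob_mono hp0 Set.inter_subset_right
  have ha1_0 : 0 ≤ a1 := prob_nonneg hp0 _
  have ha2_0 : 0 ≤ a2 := prob_nonneg hp0 _
  have hb1_0 : 0 ≤ b1 := prob_nonneg hp0 _
  have hb2_0 : 0 ≤ b2 := prob_nonneg hp0 _
  have hA0 : 0 ≤ A₀ := prob_nonneg hp0 _
  have ha1A : a1 ≤ A₀ := prob_mono hp0 (Set.inter_subset_left.trans Set.inter_subset_left)
  have hb1A : b1 ≤ A₀ := prob_mono hp0 (Set.inter_subset_left.trans Set.inter_subset_left)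
  set u := p e₁ with hu
  set w := p e₂ with hw
  set x := prob p (avoidAll ends a₂ {a₁} ∩ connEvent ends a₂ o) with hx'
  set y := prob p (avoidAll ends a₂ {a₁} ∩ connEvent ends a₂ b) with hy'
  set πv := prob p (connEvent ends a₁ v) with hπv
  set Z := prob p (avoidAll ends a₂ {a₁}) with hZ
  have hx0 : 0 ≤ x := prob_nonneg hp _
  have hy0 : 0 ≤ y := prob_nonneg hp _
  have hπ0 : 0 ≤ πv := prob_nonneg hp _
  have hxy : 0 ≤ x * y := mul_nonneg hx0 hy0
  have hπxy : 0 ≤ πv * x * y := mul_nonneg (mul_nonneg hπ0 hx0) hy0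
  have huw : u * w ≤ 1 := by
    have := mul_le_mul_of_nonneg_left hw1 hu0; linarith only [this, hu1]
  have huwβ : u * w * β ≤ 1 := by
    have := mul_le_mul_of_nonneg_left hβ1 (mul_nonneg hu0 hw0); linarith only [this, huw]
  have huwα : u * w * α ≤ 1 := by
    have := mul_le_mul_of_nonneg_left hα1 (mul_nonneg hu0 hw0); linarith only [this, huw]
  have hM1 : 0 ≤ 1 - u * w * β := sub_nonneg.2 huwβ
  have hM2 : 0 ≤ 1 - u * w * α := sub_nonneg.2 huwα
  -- case `A₀ = 0`: the `G − v` masses under `Q` vanish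
  rcases eq_or_lt_of_le hA0 with hA | hA
  · have ha1z : a1 = 0 := le_antisymm (by rw [← hA] at ha1A; exact ha1A) ha1_0
    have hb1z : b1 = 0 := le_antisymm (by rw [← hA] at hb1A; exact hb1A) hb1_0
    rw [ha1z, hb1z]
    linarith only [hπxy]
  · -- `A₀ > 0`: `a1 ≤ xo·β` and `b1 ≤ yb·α`
    have ka : a1 ≤ xo * β := by
      have : a1 * A₀ ≤ xo * β * A₀ := by linarith only [bhk_o]
      exact le_of_mul_le_mul_right this hA
    have kb : b1 ≤ yb * α := by
      have : b1 * A₀ ≤ yb * α * A₀ := by linarith only [bhk_b]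
      exact le_of_mul_le_mul_right this hA
    -- the two slack bounds
    have c1 : 0 ≤ (1 - u) * w := mul_nonneg (sub_nonneg.2 hu1) hw0
    have c2 : 0 ≤ u * (1 - w) := mul_nonneg hu0 (sub_nonneg.2 hw1)
    have s1 : (1 - u * w * β) * ((1 - u) * w * a1) ≤ (1 - u) * w * β * x := by
      have i1 : (1 - u) * w * a1 * (1 - u * w * β) ≤ (1 - u) * w * β * (a2 + (1 - u * w) * a1) := by
        have h1 := mul_le_mul_of_nonneg_left ka c1
        have e : (1 - u) * w * β * (a2 + (1 - u * w) * a1) - (1 - u) * w * a1 * (1 - u * w * β) =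
            (1 - u) * w * (xo * β - a1) := by rw [← hxo_split]; ring
        have h1' : 0 ≤ (1 - u) * w * (xo * β - a1) := by linarith only [h1]
        linarith only [e, h1']
      have i2 : a2 + (1 - u * w) * a1 ≤ x := by
        rw [← hxo_split] at hx; linarith only [hx]
      have c3 : 0 ≤ (1 - u) * w * β := mul_nonneg c1 hβ0
      have h2 := mul_le_mul_of_nonneg_left i2 c3
      linarith only [i1, h2]
    have s2 : (1 - u * w * α) * (u * (1 - w) * b1) ≤ u * (1 - w) * α * y := by
      have i1 : u * (1 - w) * b1 * (1 - u * w * α) ≤ u * (1 - w) * α * (b2 + (1 - u * w) * b1) := by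
        have h1 := mul_le_mul_of_nonneg_left kb c2
        have e : u * (1 - w) * α * (b2 + (1 - u * w) * b1) - u * (1 - w) * b1 * (1 - u * w * α) =
            u * (1 - w) * (yb * α - b1) := by rw [← hyb_split]; ring
        have h1' : 0 ≤ u * (1 - w) * (yb * α - b1) := by linarith only [h1]
        linarith only [e, h1']
      have i2 : b2 + (1 - u * w) * b1 ≤ y := by
        rw [← hyb_split] at hy; linarith only [hy]
      have c3 : 0 ≤ u * (1 - w) * α := mul_nonneg c2 hα0
      have h2 := mul_le_mul_of_nonneg_left i2 c3
      linarith only [i1, h2]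
    have star := star_ineq (γ := γ) hu0 hu1 hw0 hw1 hα0 hα1 hβ0 hβ1 hγα hγβ
    -- multiply the target by `M = (1 − uwβ)(1 − uwα) ≥ 0`
    have t1 := mul_le_mul_of_nonneg_left (mul_le_mul_of_nonneg_left s1 hy0) hM2
    have t2 := mul_le_mul_of_nonneg_left (mul_le_mul_of_nonneg_left s2 hx0) hM1
    have t3 := mul_le_mul_of_nonneg_left hπ (mul_nonneg (mul_nonneg hM1 hM2) hxy)
    have t4 := mul_le_mul_of_nonneg_left star hxy
    have key : 0 ≤ (1 - u * w * β) * (1 - u * w * α) *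
        (2 * Z * 0 - y * ((1 - u) * w * a1) + πv * x * y - x * (u * (1 - w) * b1)) := by
      linarith only [t1, t2, t3, t4]
    rcases eq_or_lt_of_le (mul_nonneg hM1 hM2) with hM | hM
    · -- `M = 0`: then `u = w = 1` and both slack terms vanish
      have hwβ1 : w * β ≤ 1 := by
        have := mul_le_mul_of_nonneg_left hβ1 hw0; linarith only [this, hw1]
      have hwα1 : w * α ≤ 1 := by
        have := mul_le_mul_of_nonneg_left hα1 hw0; linarith only [this, hw1]
      have huβ1 : u * β ≤ 1 := by
        have := mul_le_mul_of_nonneg_left hβ1 hu0; linarith only [this, hu1]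
      have huα1 : u * α ≤ 1 := by
        have := mul_le_mul_of_nonneg_left hα1 hu0; linarith only [this, hu1]
      have huw : u = 1 ∧ w = 1 := by
        rcases mul_eq_zero.1 hM.symm with h | h
        · have e1 : u * w * β ≤ u := by
            have := mul_le_mul_of_nonneg_left hwβ1 hu0; linarith only [this]
          have e2 : u * w * β ≤ w := by
            have := mul_le_mul_of_nonneg_left huβ1 hw0; linarith only [this]
          exact ⟨le_antisymm hu1 (by linarith only [h, e1]),
            le_antisymm hw1 (by linarith only [h, e2])⟩
        · have e1 : u * w * α ≤ u := by
            have := mul_le_mul_of_nonneg_left hwα1 hu0; linarith only [this]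
          have e2 : u * w * α ≤ w := by
            have := mul_le_mul_of_nonneg_left huα1 hw0; linarith only [this]
          exact ⟨le_antisymm hu1 (by linarith only [h, e1]),
            le_antisymm hw1 (by linarith only [h, e2])⟩
      rw [huw.1, huw.2]
      linarith only [hπxy]
    · exact (mul_nonneg_iff_of_pos_left hM).1 key

end Main

/-! ## The pendant-root closers on the class -/

section Assembly

variable {V : Type*} {E : Type*} [Fintype E] [DecidableEq E] [Fintype V] [DecidableEq V]
  {R : Type*} [Field R] [LinearOrder R] [IsStrictOrderedRing R]
variable {ends : E → Sym2 V} {p : E → R} {e : E} {a₂ z : V}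

/-- **Row (LEAF-½) at a pendant root when `v` is adjacent exactly to `o` and `b`**: the row at the
contraction `a₂ := z` gives the row at the pendant instance, for every weight of the root edge. -/
theorem LeafRow_pendant_root_of_star (hp : IsProbVec p) (hleaf : ∀ f, a₂ ∈ ends f → f = e)
    (hends : ends e = s(a₂, z)) {o a₁ v b : V} (ho : o ≠ a₂) (h1 : a₁ ≠ a₂) (hv : v ≠ a₂)
    (hb : b ≠ a₂) {e₁ e₂ : E} (h₁ : ends e₁ = s(v, o)) (h₂ : ends e₂ = s(v, b))
    (hstar : ∀ f, v ∈ ends f → f = e₁ ∨ f = e₂) (hvo : v ≠ o) (hvb : v ≠ b) (hv1 : v ≠ a₁)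
    (h12 : e₁ ≠ e₂) (hrow : LeafRow (Function.update p e 1) ends o a₁ a₂ v b) :
    LeafRow p ends o a₁ a₂ v b :=
  LeafRow_pendant_root_of_crossA'so hp hleaf hends ho h1 hv hb hrow
    (crossA'so_nonneg_of_star (hp.update e zero_le_one le_rfl) h₁ h₂ hstar hvo hvb hv1 hv h12)

end Assembly

end LeafRowPendantRootStarOB

end Summit.Ventures.PercRepro2
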